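import Summits.QuantumFields.YangMills.Theorems.BalabanUVNodesN15CurvedGluingCubeAdjointRowSandwichDefect
import HarnessLib

/-!
# THE TWO-SPACING η-DEFECT OF THE ADJOINT REMAINDER ROW OF THE ADJOINT-SIDE DRESSED SMOOTH-CUT CUBE `X°` (FILE 147∕149's `hDK` at `G_□ := X°`): FILE 155's generic theorem run at
# `G := X°`, `G′ := X°′` with the sandwiched right entries `X°∘∇^±∘M_χ = (Ñ_𝒲∘M_χ̃∘T^±)∘M_χ` (FILE 153 §1) at both grids, their fine rows (FILE 153 ★) and their defects (FILE 148 §3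
# `hasMaj_idef_neumannR_comp_loc₂` behind `𝔇(M_χ̃′T′, M_χ̃T)`), NO mixed `∇N∇` row (dag-n15-c g18, FILE 156; N15 = NE2, s1 «background-layer OPERATOR ingredient»)

Cell `pub-ymgap`, seat `pub-ymgap-dag-n15-c` (R134 (a); HUMAN RULING D-0062), generation 18.  `bears_on: R4∕N15 · K3⁸ SpineGivenEndpointR13SepCoPHV (stmt-QuantumFields-27366)`.
Filed `--kind proof --supports stmt-QuantumFields-27366 --as helper` — COUNT-NEUTRAL.  Theorems only; 0 `def`, 0 `sorry`.  Imports BY NAME FILE 155 `…CubeAdjointRowSandwichDefect`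
(`hasMaj_idef_comp_commOp_cubeOp_out_of_sandwich`) and through it FILE 153 (`smoothCutDressed_comp_grad_sandwich`, `hasMaj_adjRightEntry_loc₂`), FILE 150 (`loc₂_le_plain`, `exp_rate_mono`),
FILE 148 (`hasMaj_idef_neumannR_comp_loc₂`, `isUnit_neumannR`), dag-n15-w3 file 34 (`hasMaj_smoothCutDressed_loc₂`, `hasMaj_smoothCut_flat`, `hasMaj_jet_smoothCut_flat`), dag-n15-w3
`hasMaj_dressedV_pair`, n15-w3 `hasMaj_diag_comp`, lit `idef_comp`, `hasMaj_idef_mulOp`, `hasMaj_mulOp`.  Nothing in the tree is modified; nothing restated.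

WHY.  FILE 153 is the ONE-GRID adjoint remainder row of `X°` (FILE 147∕149's `hKc`); FILE 155 is the generic two-grid `hDK`.  THIS FILE is the plumbing that runs FILE 155 at the concrete
adjoint-side dressed cube: the only new estimate is §1's `𝔇(M_{a′}T′, M_aT) ≤ (c·r_T + o·k_T)e^{−δd}` (Leibniz for the defect of a bounded, fitted multiplier in front of a row), which with
FILE 148 §3 gives the defects of the adjoint right entries `T^X = Ñ_𝒲∘M_χ̃∘T^±_N` from the defects `m^Q` of the flat cube's sandwiched operators `T^±_N` (dag-n15-a N-IIn (c)⁻ ∕ N-IIr (c)⁺ shapes at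
the cover), the bump fit `o_χ`, and the adjoint letter's defect `𝔇(𝒲′,𝒲) ≤ r_𝒲e^{−δ_Wd}` (FILE 151, dropped to plain currency).  Entry 0's two-grid defect `𝔇(X°′, X°) ≤ 1_S1_S·m^Xe^{−ρ₂d}`
enters BY LETTER (`hDG0`; dag-n15-w3 file 35 `hasMaj_idef_smoothCutDressed_loc₂` supplies it at the cover), as does the `W`-rows' defect `r_W`.

WHAT.  §1 `hasMaj_idef_mulOp_comp_plain`.  §2 ★★★ `hasMaj_idef_smoothCutDressed_comp_commOp_cubeOp_out_of_sandwich`: under FILE 153's one-grid data AT BOTH GRIDS (same letters), the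
fits of FILE 155, `hDG0`, `𝔇(T′^±_N, T^±_N) ≤ m^Qe^{−δ_Wd}`, `𝔇(𝒲′,𝒲) ≤ r_𝒲e^{−δ_Wd}`, `|χ̃′ − χ̃∘π| ≤ o_χ`:  `𝔇(X°′∘[lapOp′ W′ + N_L′ − 𝒱′, M_{h′}], X°∘[lapOp W + N_L − 𝒱, M_h]) ≤
1_S(y)·Θ_D(β̄′, m^X, β^X, m^{TX}, …)·e^{−ρ₃d}` — FILE 155's constant at `β := β̄′ = β̄(1 − β̄Rc_r²)⁻¹`, `m₀ := m^X`, `β₁ := β^X = (1 − θ_𝒲c_r)⁻¹β^Qc_r`,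
`m₁ := m^{TX} = (1 − θ_𝒲c_r)⁻¹(m^Q + o_χβ^Q)c_r + (1 − θ_𝒲c_r)⁻¹·r_𝒲β^Xc_r·c_r`.

HONEST FRAMING ∕ LIMITS.  Block-majorant bookkeeping over DISPLAYED letters at both grids; proves NO estimate of any concrete propagator; nothing of [B5]∕[B6]∕[B9] asserted ((1.120)–(1.128),
(2.91)–(2.92) p.239, (2.133)–(2.134) p.247, (3.52) p.400, (3.62)–(3.65) pp.402–403, (3.76)–(3.77) pp.405–406 = SHAPES; Thm 3.14 pp.426–427 = difference TEMPLATE).  NE2⁺ NOT PRINTED, NOT proved; N15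
NOT discharged; K3⁸ OPEN, skeleton v7 untouched (0∕2); counts of record UNMOVED by this seat (typed 28∕28 · discharged 7∕28 = 7∕27 excl. NODE O, №245); one finite 𝕋⁴ at fixed ε — NOT infinite
volume, NOT OS on ℝ⁴, NOT a mass gap, NOT Clay; R4 closes the conditional finite-𝕋⁴ rung `BalabanLadder.UV` only.  Restate-immune (no Theses import).
-/

set_option autoImplicit false

noncomputable section
open scoped BigOperators
open Finset

namespace Summit.QuantumFields.YangMills.BalabanUVNodes.N15.Gluing

open Literature.MathematicalPhysics.QuantumFieldTheory.Balaban1983to89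
open Literature.MathematicalPhysics.QuantumFieldTheory.Balaban1983to89.B11SectG (BlockNorm HasMaj RowSum)
open Literature.MathematicalPhysics.QuantumFieldTheory.Balaban1983to89.B6RandomWalk (Triangle254)
open Literature.MathematicalPhysics.QuantumFieldTheory.Balaban1983to89.T4EtaRateDefect (idef idef_comp)
open Literature.MathematicalPhysics.QuantumFieldTheory.Balaban1983to89.T4EtaRateCoeffDefect (pull diagK diagK_nonneg hasMaj_mulOp hasMaj_idef_mulOp)
open Literature.MathematicalPhysics.QuantumFieldTheory.Balaban1983to89.B6Prop26Gluing (mulOp mulOp_apply ind ind_nonneg ind_le_one)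
open Summit.QuantumFields.YangMills.BalabanUVNodes.N15.MatrixSpecies (mmulOp liftBlk liftMap liftEquiv liftEquiv_apply liftEquiv_symm_apply)
open Summit.QuantumFields.YangMills.BalabanUVNodes.N15.BackgroundLayer (fgrad bgrad fgradAdj fgrad_apply bgrad_apply stack projO projO_none_comp_stack unstackM bgPropV blkPair fgradMat)
open Summit.QuantumFields.YangMills.BalabanUVNodes.N15.CurvedSpecies (hasMaj_smoothCutDressed_loc₂ hasMaj_smoothCut_flat hasMaj_jet_smoothCut_flat smoothCut_out smoothCut_in hasMaj_dressedV_pair)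

variable {X X' ι J : Type} [Fintype X] [Fintype X'] [DecidableEq X] [DecidableEq X'] [Fintype ι] [DecidableEq ι] [Fintype J] [DecidableEq J] {g : B6.Geometry} (blk : X → g.Site) (π : X' → X)
  (τ : J → X ≃ X) (τ' : J → X' ≃ X') (n n' : ℝ) (C : X → Matrix ι ι ℝ) (C' : X' → Matrix ι ι ℝ) (A : J ⊕ J → X → Matrix ι ι ℝ) (A' : J ⊕ J → X' → Matrix ι ι ℝ) (hX : X → ℝ) (hX' : X' → ℝ)
  {σ cr : ℝ} {N : (X × ι → ℝ) →ₗ[ℝ] (X × ι → ℝ)} {N' : (X' × ι → ℝ) →ₗ[ℝ] (X' × ι → ℝ)} {χX χtX ψ₂X : X → ℝ} {χX' χtX' ψX' ψ₂X' : X' → ℝ} {S : Set g.Site}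
  {W NL NV : (X × ι → ℝ) →ₗ[ℝ] (X × ι → ℝ)} {W' NL' NV' : (X' × ι → ℝ) →ₗ[ℝ] (X' × ι → ℝ)} {Tf Tb : J → (X × ι → ℝ) →ₗ[ℝ] (X × ι → ℝ)} {Tf' Tb' : J → (X' × ι → ℝ) →ₗ[ℝ] (X' × ι → ℝ)}

/-! ## §1 The defect of a bounded, fitted multiplier in front of a row, plain currency -/

omit [Fintype J] [DecidableEq J] [DecidableEq X] [DecidableEq X'] [DecidableEq ι] in
/-- LEIBNIZ FOR A MULTIPLIER's DEFECT: `|a′| ≤ c`, `|a′ − a∘π| ≤ o`, `T ≤ k_Te^{−δd}`, `𝔇(T′,T) ≤ r_Te^{−δd}` ⟹ `𝔇(M_{a′}∘T′, M_a∘T) ≤ (c·r_T + o·k_T)e^{−δd}` (`idef_comp`: fine factor left of the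
defect, coarse factor right of it). [cite: Balaban1985BackgroundPropagators, Thm 3.14 pp.426–427 (difference template)] -/
theorem hasMaj_idef_mulOp_comp_plain {T : (X × ι → ℝ) →ₗ[ℝ] (X × ι → ℝ)} {T' : (X' × ι → ℝ) →ₗ[ℝ] (X' × ι → ℝ)} {a : X → ℝ} {a' : X' → ℝ} {c o k r δ : ℝ} (hc : 0 ≤ c) (ho : 0 ≤ o)
    (ha' : ∀ x', |a' x'| ≤ c) (hfit : ∀ x', |a' x' - a (π x')| ≤ o)
    (hT : HasMaj (BlockNorm.ofBlocks g (liftBlk blk ι)) (BlockNorm.ofBlocks g (liftBlk blk ι)) T (fun y y' => k * Real.exp (-(δ * g.dist y y'))))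
    (hD : HasMaj (BlockNorm.ofBlocks g (liftBlk blk ι)) (BlockNorm.ofBlocks g (liftBlk (blk ∘ π) ι)) (idef (pull (liftMap π ι)) (pull (liftMap π ι)) T' T) (fun y y' => r * Real.exp (-(δ * g.dist y y')))) :
    HasMaj (BlockNorm.ofBlocks g (liftBlk blk ι)) (BlockNorm.ofBlocks g (liftBlk (blk ∘ π) ι))
      (idef (pull (liftMap π ι)) (pull (liftMap π ι)) (mulOp (fun p : X' × ι => a' p.1) ∘ₗ T') (mulOp (fun p : X × ι => a p.1) ∘ₗ T)) (fun y y' => (c * r + o * k) * Real.exp (-(δ * g.dist y y'))) := by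
  rw [idef_comp (pull (liftMap π ι)) (pull (liftMap π ι)) (pull (liftMap π ι)) (mulOp (fun p : X' × ι => a' p.1)) T' (mulOp (fun p : X × ι => a p.1)) T]
  have t1 := hasMaj_diag_comp (liftBlk (blk ∘ π) ι) (m := fun _ => c) (fun _ => hc) (hasMaj_mulOp (g := g) (liftBlk (blk ∘ π) ι) (m := fun _ => c) (fun _ => hc) (fun p' : X' × ι => ha' p'.1)) hD
  have hDa := hasMaj_idef_mulOp (g := g) (liftBlk blk ι) (liftMap π ι) (a' := fun p : X' × ι => a' p.1) (a := fun p : X × ι => a p.1) (o := fun _ => o) (fun _ => ho) (fun p' => hfit p'.1)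
  have t2 := hasMaj_diag_comp (liftBlk blk ι) (m := fun _ => o) (fun _ => ho) hDa hT
  refine (t1.add t2).mono fun y y' => le_of_eq ?_
  ring

/-! ## §2 FILE 155 at the adjoint-side dressed smooth-cut cube -/

/-- ★★★ **THE TWO-SPACING η-DEFECT OF THE ADJOINT REMAINDER ROW OF `X°`, FROM SANDWICHED RIGHT ENTRIES** (FILE 147∕149's `hDK` at `G_□ := X°`).  Data: FILE 153's one-grid data AT BOTH GRIDS with the
same letters (cut rows `β, β₁` at rate `δ` and the bump letters∕insertions of dag-n15-w3 file 34, input cuts `N = NM_ψ`, the perturbation letter `R` at rate `δ_V` with `β̄Rc_r² < 1`, the adjoint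
letters `𝒲, 𝒲′ ≤ θ_𝒲e^{−δ_Wd}` with `θ_𝒲c_r < 1` (the coarse input cut `N = NM_ψ` and `supp ψ` are NOT needed: only the fine entry-0 row enters), the sandwiches `N∘∇^±_μ∘M_χ = T^±_μ∘M_χ` with rows `T^± ≤ 1_S1_S·β^Qe^{−δ_Wd}`, `T^±M_{ψ₂} = T^±`, cut supports over `S`); the two-grid
letters: entry 0's defect `𝔇(X°′, X°) ≤ 1_S1_S·m^Xe^{−ρ₂d}` (`hDG0`), the sandwiched operators' defects `𝔇(T′^±, T^±) ≤ m^Qe^{−δ_Wd}`, `𝔇(𝒲′,𝒲) ≤ r_𝒲e^{−δ_Wd}`, the bump fit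
`|χ̃′ − χ̃∘π| ≤ o_χ`, the `W`-rows' defect `r_W` (rate `ρ₂`), the partition's letters and fits at both grids (FILE 155's), transition layers inside the cuts, species rows `r_A` ∕ fits `o_At`,
nonlocal commutator letters `c_N, r_N` (rate `ρ_N`), base parts `R_N, r_V` (rate `δ_N`); rates `σ ≤ ρ₁ ≤ δ_V`, `ρ₁ + σ ≤ δ`, `ρ₂ + σ ≤ ρ₁`, `ρ₂ + 2σ ≤ δ_W`, `0 ≤ ρ₃ ≤ ρ_N`, `ρ₃ ≤ δ_N − ε`,
`ρ₃ + σ ≤ ρ₂`.  Then `𝔇(X°′∘[lapOp′ W′ + N_L′ − 𝒱′, M_{h′}], X°∘[lapOp W + N_L − 𝒱, M_h]) ≤ 1_S(y)·Θ_D·e^{−ρ₃d}` with FILE 155's `Θ_D` at `β := β̄′`, `m₀ := m^X`, `β₁ := β^X`, `m₁ := m^{TX}`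
(module docstring). [cite: Balaban1984PropagatorsI, (1.120)–(1.128) pp.37–38, p.39; Balaban1984PropagatorsII, (2.91)–(2.92) p.239, (2.133)–(2.134) p.247 (shapes, transposed); Balaban1985BackgroundPropagators, (3.52) p.400, (3.62)–(3.65) pp.402–403, (3.76)–(3.77) pp.405–406, Thm 3.14 pp.426–427 (difference template)] -/
theorem hasMaj_idef_smoothCutDressed_comp_commOp_cubeOp_out_of_sandwich (htri : Triangle254 g) (hd : ∀ a b : g.Site, 0 ≤ g.dist a b) (hsymm : ∀ y y', g.dist y y' = g.dist y' y)
    (hd0 : ∀ y : g.Site, g.dist y y = 0) (hrow : RowSum g σ cr) (hσ : 0 ≤ σ)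
    {ρ₁ ρ₂ ρ₃ ρN δV δN δW ε R c₀ c₁ c₂ o₀ o₁ o₂ o rW cN rN rA oAt RN rV ℓ ω β β₁ ct δ βQ θA mX mQ r𝒲 oχ : ℝ} {hb : g.Site → ℝ}
    (hβ : 0 ≤ β) (hβ₁ : 0 ≤ β₁) (hβQ : 0 ≤ βQ) (hct : 0 ≤ ct) (hR : 0 ≤ R) (hcr : 0 ≤ cr) (hc₀ : 0 ≤ c₀) (hc₁ : 0 ≤ c₁) (hc₂ : 0 ≤ c₂) (ho₀ : 0 ≤ o₀) (ho₁ : 0 ≤ o₁) (ho₂ : 0 ≤ o₂) (ho : 0 ≤ o)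
    (hrW : 0 ≤ rW) (hcN : 0 ≤ cN) (hrN : 0 ≤ rN) (hrA : 0 ≤ rA) (hoAt : 0 ≤ oAt) (hRN : 0 ≤ RN) (hrV : 0 ≤ rV) (hℓ : 0 ≤ ℓ) (hω : 0 ≤ ω) (hθA : 0 ≤ θA) (hmX : 0 ≤ mX) (hmQ : 0 ≤ mQ)
    (hr𝒲 : 0 ≤ r𝒲) (hoχ : 0 ≤ oχ) (hε : 0 < ε)
    (hσρ : σ ≤ ρ₁) (hρ₁V : ρ₁ ≤ δV) (hρ₁G : ρ₁ + σ ≤ δ) (hρ₂ : 0 ≤ ρ₂) (hρ₂₁ : ρ₂ + σ ≤ ρ₁) (hρ₃ : 0 ≤ ρ₃) (hρ₃N : ρ₃ ≤ ρN) (hρ₃V : ρ₃ ≤ δN - ε) (hρ₃₂ : ρ₃ + σ ≤ ρ₂)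
    (hρ₂W : ρ₂ + 2 * σ ≤ δW)
    -- cuts, coarse grid
    (hSχ : ∀ x, χX x ≠ 0 → blk x ∈ S) (hSψ₂ : ∀ x, ψ₂X x ≠ 0 → blk x ∈ S) (hχt : ∀ x, |χtX x| ≤ 1)
    (hdχt : ∀ μ p, |fgrad n (liftEquiv (τ μ) ι) (fun p : X × ι => χtX p.1) p| ≤ ct) (hdχtb : ∀ μ p, |bgrad n (liftEquiv (τ μ) ι) (fun p : X × ι => χtX p.1) p| ≤ ct)
    (hsub : mulOp (fun p : X × ι => χtX p.1) ∘ₗ mulOp (fun p : X × ι => χX p.1) = mulOp (fun p : X × ι => χtX p.1))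
    (hχ : mulOp (fun p : X × ι => χX p.1) ∘ₗ mulOp (fun p : X × ι => χtX p.1) = mulOp (fun p : X × ι => χtX p.1))
    (hs : ∀ μ, mulOp ((fun p : X × ι => χtX p.1) ∘ (liftEquiv (τ μ) ι)) ∘ₗ mulOp (fun p : X × ι => χX p.1) = mulOp ((fun p : X × ι => χtX p.1) ∘ (liftEquiv (τ μ) ι)))
    (hsb : ∀ μ, mulOp ((fun p : X × ι => χtX p.1) ∘ (liftEquiv (τ μ) ι).symm) ∘ₗ mulOp (fun p : X × ι => χX p.1) = mulOp ((fun p : X × ι => χtX p.1) ∘ (liftEquiv (τ μ) ι).symm))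
    (hdd : ∀ μ, mulOp (fgrad n (liftEquiv (τ μ) ι) (fun p : X × ι => χtX p.1)) ∘ₗ mulOp (fun p : X × ι => χX p.1) = mulOp (fgrad n (liftEquiv (τ μ) ι) (fun p : X × ι => χtX p.1)))
    (hddb : ∀ μ, mulOp (bgrad n (liftEquiv (τ μ) ι) (fun p : X × ι => χtX p.1)) ∘ₗ mulOp (fun p : X × ι => χX p.1) = mulOp (bgrad n (liftEquiv (τ μ) ι) (fun p : X × ι => χtX p.1)))
    -- cuts, fine grid (the fine input cut `N′ = N′M_{ψ′}` is used for the fine row; the coarse one is not needed)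
    (hSχ' : ∀ x', χX' x' ≠ 0 → blk (π x') ∈ S) (hSψ' : ∀ x', ψX' x' ≠ 0 → blk (π x') ∈ S) (hSψ₂' : ∀ x', ψ₂X' x' ≠ 0 → blk (π x') ∈ S) (hχt' : ∀ x', |χtX' x'| ≤ 1)
    (hdχt' : ∀ μ p', |fgrad n' (liftEquiv (τ' μ) ι) (fun p : X' × ι => χtX' p.1) p'| ≤ ct) (hdχtb' : ∀ μ p', |bgrad n' (liftEquiv (τ' μ) ι) (fun p : X' × ι => χtX' p.1) p'| ≤ ct)
    (hsub' : mulOp (fun p : X' × ι => χtX' p.1) ∘ₗ mulOp (fun p : X' × ι => χX' p.1) = mulOp (fun p : X' × ι => χtX' p.1))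
    (hχ' : mulOp (fun p : X' × ι => χX' p.1) ∘ₗ mulOp (fun p : X' × ι => χtX' p.1) = mulOp (fun p : X' × ι => χtX' p.1))
    (hs' : ∀ μ, mulOp ((fun p : X' × ι => χtX' p.1) ∘ (liftEquiv (τ' μ) ι)) ∘ₗ mulOp (fun p : X' × ι => χX' p.1) = mulOp ((fun p : X' × ι => χtX' p.1) ∘ (liftEquiv (τ' μ) ι)))
    (hsb' : ∀ μ, mulOp ((fun p : X' × ι => χtX' p.1) ∘ (liftEquiv (τ' μ) ι).symm) ∘ₗ mulOp (fun p : X' × ι => χX' p.1) = mulOp ((fun p : X' × ι => χtX' p.1) ∘ (liftEquiv (τ' μ) ι).symm))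
    (hdd' : ∀ μ, mulOp (fgrad n' (liftEquiv (τ' μ) ι) (fun p : X' × ι => χtX' p.1)) ∘ₗ mulOp (fun p : X' × ι => χX' p.1) = mulOp (fgrad n' (liftEquiv (τ' μ) ι) (fun p : X' × ι => χtX' p.1)))
    (hddb' : ∀ μ, mulOp (bgrad n' (liftEquiv (τ' μ) ι) (fun p : X' × ι => χtX' p.1)) ∘ₗ mulOp (fun p : X' × ι => χX' p.1) = mulOp (bgrad n' (liftEquiv (τ' μ) ι) (fun p : X' × ι => χtX' p.1)))
    (hNψ' : N' ∘ₗ mulOp (fun p : X' × ι => ψX' p.1) = N')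
    (hfitχ : ∀ x', |χtX' x' - χtX (π x')| ≤ oχ)
    -- the flat cubes: left cut rows (both grids), SANDWICHED right entries (both grids), rows, defects
    (hcut : HasMaj (BlockNorm.ofBlocks g (liftBlk blk ι)) (BlockNorm.ofBlocks g (liftBlk blk ι)) (mulOp (fun p : X × ι => χX p.1) ∘ₗ N) (fun y y' => ind S y * ind S y' * (β * Real.exp (-(δ * g.dist y y')))))
    (hcutF : ∀ μ, HasMaj (BlockNorm.ofBlocks g (liftBlk blk ι)) (BlockNorm.ofBlocks g (liftBlk blk ι)) (mulOp (fun p : X × ι => χX p.1) ∘ₗ (fgrad n (liftEquiv (τ μ) ι) ∘ₗ N))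
      (fun y y' => ind S y * ind S y' * (β₁ * Real.exp (-(δ * g.dist y y')))))
    (hcutB : ∀ μ, HasMaj (BlockNorm.ofBlocks g (liftBlk blk ι)) (BlockNorm.ofBlocks g (liftBlk blk ι)) (mulOp (fun p : X × ι => χX p.1) ∘ₗ (bgrad n (liftEquiv (τ μ) ι) ∘ₗ N))
      (fun y y' => ind S y * ind S y' * (β₁ * Real.exp (-(δ * g.dist y y')))))
    (hcut' : HasMaj (BlockNorm.ofBlocks g (liftBlk (blk ∘ π) ι)) (BlockNorm.ofBlocks g (liftBlk (blk ∘ π) ι)) (mulOp (fun p : X' × ι => χX' p.1) ∘ₗ N') (fun y y' => ind S y * ind S y' * (β * Real.exp (-(δ * g.dist y y')))))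
    (hcutF' : ∀ μ, HasMaj (BlockNorm.ofBlocks g (liftBlk (blk ∘ π) ι)) (BlockNorm.ofBlocks g (liftBlk (blk ∘ π) ι)) (mulOp (fun p : X' × ι => χX' p.1) ∘ₗ (fgrad n' (liftEquiv (τ' μ) ι) ∘ₗ N'))
      (fun y y' => ind S y * ind S y' * (β₁ * Real.exp (-(δ * g.dist y y')))))
    (hcutB' : ∀ μ, HasMaj (BlockNorm.ofBlocks g (liftBlk (blk ∘ π) ι)) (BlockNorm.ofBlocks g (liftBlk (blk ∘ π) ι)) (mulOp (fun p : X' × ι => χX' p.1) ∘ₗ (bgrad n' (liftEquiv (τ' μ) ι) ∘ₗ N'))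
      (fun y y' => ind S y * ind S y' * (β₁ * Real.exp (-(δ * g.dist y y')))))
    (hTf : ∀ μ, N ∘ₗ fgrad n (liftEquiv (τ μ) ι) ∘ₗ mulOp (fun p : X × ι => χX p.1) = Tf μ ∘ₗ mulOp (fun p : X × ι => χX p.1))
    (hTb : ∀ μ, N ∘ₗ bgrad n (liftEquiv (τ μ) ι) ∘ₗ mulOp (fun p : X × ι => χX p.1) = Tb μ ∘ₗ mulOp (fun p : X × ι => χX p.1))
    (hTf' : ∀ μ, N' ∘ₗ fgrad n' (liftEquiv (τ' μ) ι) ∘ₗ mulOp (fun p : X' × ι => χX' p.1) = Tf' μ ∘ₗ mulOp (fun p : X' × ι => χX' p.1))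
    (hTb' : ∀ μ, N' ∘ₗ bgrad n' (liftEquiv (τ' μ) ι) ∘ₗ mulOp (fun p : X' × ι => χX' p.1) = Tb' μ ∘ₗ mulOp (fun p : X' × ι => χX' p.1))
    (hTfr : ∀ μ, HasMaj (BlockNorm.ofBlocks g (liftBlk blk ι)) (BlockNorm.ofBlocks g (liftBlk blk ι)) (Tf μ) (fun y y' => ind S y * ind S y' * (βQ * Real.exp (-(δW * g.dist y y')))))
    (hTbr : ∀ μ, HasMaj (BlockNorm.ofBlocks g (liftBlk blk ι)) (BlockNorm.ofBlocks g (liftBlk blk ι)) (Tb μ) (fun y y' => ind S y * ind S y' * (βQ * Real.exp (-(δW * g.dist y y')))))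
    (hTfr' : ∀ μ, HasMaj (BlockNorm.ofBlocks g (liftBlk (blk ∘ π) ι)) (BlockNorm.ofBlocks g (liftBlk (blk ∘ π) ι)) (Tf' μ) (fun y y' => ind S y * ind S y' * (βQ * Real.exp (-(δW * g.dist y y')))))
    (hTbr' : ∀ μ, HasMaj (BlockNorm.ofBlocks g (liftBlk (blk ∘ π) ι)) (BlockNorm.ofBlocks g (liftBlk (blk ∘ π) ι)) (Tb' μ) (fun y y' => ind S y * ind S y' * (βQ * Real.exp (-(δW * g.dist y y')))))
    (hTfψ : ∀ μ, Tf μ ∘ₗ mulOp (fun p : X × ι => ψ₂X p.1) = Tf μ) (hTbψ : ∀ μ, Tb μ ∘ₗ mulOp (fun p : X × ι => ψ₂X p.1) = Tb μ)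
    (hTfψ' : ∀ μ, Tf' μ ∘ₗ mulOp (fun p : X' × ι => ψ₂X' p.1) = Tf' μ) (hTbψ' : ∀ μ, Tb' μ ∘ₗ mulOp (fun p : X' × ι => ψ₂X' p.1) = Tb' μ)
    (hDTf : ∀ μ, HasMaj (BlockNorm.ofBlocks g (liftBlk blk ι)) (BlockNorm.ofBlocks g (liftBlk (blk ∘ π) ι)) (idef (pull (liftMap π ι)) (pull (liftMap π ι)) (Tf' μ) (Tf μ)) (fun y y' => mQ * Real.exp (-(δW * g.dist y y'))))
    (hDTb : ∀ μ, HasMaj (BlockNorm.ofBlocks g (liftBlk blk ι)) (BlockNorm.ofBlocks g (liftBlk (blk ∘ π) ι)) (idef (pull (liftMap π ι)) (pull (liftMap π ι)) (Tb' μ) (Tb μ)) (fun y y' => mQ * Real.exp (-(δW * g.dist y y'))))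
    -- the perturbation's letter at both grids and smallness; the adjoint letters `𝒲, 𝒲′` and their defect
    (hV : HasMaj (BlockNorm.ofBlocks g (blkPair (liftBlk blk ι))) (BlockNorm.ofBlocks g (liftBlk blk ι)) (unstackM C A + NV ∘ₗ projO (none : Option (J ⊕ J))) (fun y y' => R * Real.exp (-(δV * g.dist y y'))))
    (hV' : HasMaj (BlockNorm.ofBlocks g (blkPair (liftBlk (blk ∘ π) ι))) (BlockNorm.ofBlocks g (liftBlk (blk ∘ π) ι)) (unstackM C' A' + NV' ∘ₗ projO (none : Option (J ⊕ J))) (fun y y' => R * Real.exp (-(δV * g.dist y y'))))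
    (hq : (β + (β₁ + ct * β)) * (R * cr) * cr < 1)
    (hW𝒲 : HasMaj (BlockNorm.ofBlocks g (liftBlk blk ι)) (BlockNorm.ofBlocks g (liftBlk blk ι))
      ((mulOp (fun p : X × ι => χtX p.1) ∘ₗ N) ∘ₗ (unstackM C A + NV ∘ₗ projO (none : Option (J ⊕ J))) ∘ₗ
        stack LinearMap.id (fun j => Sum.elim (fun μ => fgrad n (liftEquiv (τ μ) ι)) (fun μ => bgrad n (liftEquiv (τ μ) ι)) j) ∘ₗ mulOp (fun p : X × ι => χX p.1))
      (fun y y' => θA * Real.exp (-(δW * g.dist y y'))))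
    (hW𝒲' : HasMaj (BlockNorm.ofBlocks g (liftBlk (blk ∘ π) ι)) (BlockNorm.ofBlocks g (liftBlk (blk ∘ π) ι))
      ((mulOp (fun p : X' × ι => χtX' p.1) ∘ₗ N') ∘ₗ (unstackM C' A' + NV' ∘ₗ projO (none : Option (J ⊕ J))) ∘ₗ
        stack LinearMap.id (fun j => Sum.elim (fun μ => fgrad n' (liftEquiv (τ' μ) ι)) (fun μ => bgrad n' (liftEquiv (τ' μ) ι)) j) ∘ₗ mulOp (fun p : X' × ι => χX' p.1))
      (fun y y' => θA * Real.exp (-(δW * g.dist y y')))) (hqA : θA * cr < 1)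
    (hD𝒲 : HasMaj (BlockNorm.ofBlocks g (liftBlk blk ι)) (BlockNorm.ofBlocks g (liftBlk (blk ∘ π) ι))
      (idef (pull (liftMap π ι)) (pull (liftMap π ι))
        ((mulOp (fun p : X' × ι => χtX' p.1) ∘ₗ N') ∘ₗ (unstackM C' A' + NV' ∘ₗ projO (none : Option (J ⊕ J))) ∘ₗ
        stack LinearMap.id (fun j => Sum.elim (fun μ => fgrad n' (liftEquiv (τ' μ) ι)) (fun μ => bgrad n' (liftEquiv (τ' μ) ι)) j) ∘ₗ mulOp (fun p : X' × ι => χX' p.1))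
        ((mulOp (fun p : X × ι => χtX p.1) ∘ₗ N) ∘ₗ (unstackM C A + NV ∘ₗ projO (none : Option (J ⊕ J))) ∘ₗ
        stack LinearMap.id (fun j => Sum.elim (fun μ => fgrad n (liftEquiv (τ μ) ι)) (fun μ => bgrad n (liftEquiv (τ μ) ι)) j) ∘ₗ mulOp (fun p : X × ι => χX p.1)))
      (fun y y' => r𝒲 * Real.exp (-(δW * g.dist y y'))))
    -- entry 0's two-grid defect, by letter
    (hDG0 : HasMaj (BlockNorm.ofBlocks g (liftBlk blk ι)) (BlockNorm.ofBlocks g (liftBlk (blk ∘ π) ι))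
      (idef (pull (liftMap π ι)) (pull (liftMap π ι))
        (projO none ∘ₗ bgPropV (stack (mulOp (fun p : X' × ι => χtX' p.1) ∘ₗ N')
          (fun j => Sum.elim (fun μ => fgrad n' (liftEquiv (τ' μ) ι)) (fun μ => bgrad n' (liftEquiv (τ' μ) ι)) j ∘ₗ (mulOp (fun p : X' × ι => χtX' p.1) ∘ₗ N'))) (unstackM C' A' + NV' ∘ₗ projO (none : Option (J ⊕ J))))
        (projO none ∘ₗ bgPropV (stack (mulOp (fun p : X × ι => χtX p.1) ∘ₗ N)
          (fun j => Sum.elim (fun μ => fgrad n (liftEquiv (τ μ) ι)) (fun μ => bgrad n (liftEquiv (τ μ) ι)) j ∘ₗ (mulOp (fun p : X × ι => χtX p.1) ∘ₗ N))) (unstackM C A + NV ∘ₗ projO (none : Option (J ⊕ J)))))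
      (fun y y' => ind S y * ind S y' * (mX * Real.exp (-(ρ₂ * g.dist y y')))))
    -- the partition: lifted letters (coarse) and two-grid fits, scalar letters at both grids and fits, block-constant comparison, transition layers inside the cuts
    (hhD : ∀ μ p, |(fgrad n (liftEquiv (τ μ) ι) (fun p : X × ι => hX p.1) ∘ ⇑(liftEquiv (τ μ) ι).symm) p| ≤ c₁)
    (hhB : ∀ μ p, |(bgrad n (liftEquiv (τ μ) ι) (fun p : X × ι => hX p.1) ∘ ⇑(liftEquiv (τ μ) ι)) p| ≤ c₁)
    (hh2 : ∀ μ p, |fgradAdj n (liftEquiv (τ μ) ι) (fgrad n (liftEquiv (τ μ) ι) (fun p : X × ι => hX p.1)) p| ≤ c₂)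
    (hh2f : ∀ μ p, |(fgrad n (liftEquiv (τ μ) ι) (fgrad n (liftEquiv (τ μ) ι) (fun p : X × ι => hX p.1)) ∘ ⇑(liftEquiv (τ μ) ι).symm) p| ≤ c₂)
    (hh2b : ∀ μ p, |bgrad n (liftEquiv (τ μ) ι) (bgrad n (liftEquiv (τ μ) ι) (fun p : X × ι => hX p.1) ∘ ⇑(liftEquiv (τ μ) ι)) p| ≤ c₂)
    (hfD : ∀ μ p', |(fgrad n' (liftEquiv (τ' μ) ι) (fun p : X' × ι => hX' p.1) ∘ ⇑(liftEquiv (τ' μ) ι).symm) p' - (fgrad n (liftEquiv (τ μ) ι) (fun p : X × ι => hX p.1) ∘ ⇑(liftEquiv (τ μ) ι).symm) (liftMap π ι p')| ≤ o₁)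
    (hfB : ∀ μ p', |(bgrad n' (liftEquiv (τ' μ) ι) (fun p : X' × ι => hX' p.1) ∘ ⇑(liftEquiv (τ' μ) ι)) p' - (bgrad n (liftEquiv (τ μ) ι) (fun p : X × ι => hX p.1) ∘ ⇑(liftEquiv (τ μ) ι)) (liftMap π ι p')| ≤ o₁)
    (hf2 : ∀ μ p', |fgradAdj n' (liftEquiv (τ' μ) ι) (fgrad n' (liftEquiv (τ' μ) ι) (fun p : X' × ι => hX' p.1)) p' - fgradAdj n (liftEquiv (τ μ) ι) (fgrad n (liftEquiv (τ μ) ι) (fun p : X × ι => hX p.1)) (liftMap π ι p')| ≤ o₂)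
    (hf2f : ∀ μ p', |(fgrad n' (liftEquiv (τ' μ) ι) (fgrad n' (liftEquiv (τ' μ) ι) (fun p : X' × ι => hX' p.1)) ∘ ⇑(liftEquiv (τ' μ) ι).symm) p' -
      (fgrad n (liftEquiv (τ μ) ι) (fgrad n (liftEquiv (τ μ) ι) (fun p : X × ι => hX p.1)) ∘ ⇑(liftEquiv (τ μ) ι).symm) (liftMap π ι p')| ≤ o₂)
    (hf2b : ∀ μ p', |bgrad n' (liftEquiv (τ' μ) ι) (bgrad n' (liftEquiv (τ' μ) ι) (fun p : X' × ι => hX' p.1) ∘ ⇑(liftEquiv (τ' μ) ι)) p' -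
      bgrad n (liftEquiv (τ μ) ι) (bgrad n (liftEquiv (τ μ) ι) (fun p : X × ι => hX p.1) ∘ ⇑(liftEquiv (τ μ) ι)) (liftMap π ι p')| ≤ o₂)
    (hh1 : ∀ μ x, |fgrad n (τ μ) hX x| ≤ c₁) (hh1b : ∀ μ x, |bgrad n (τ μ) hX x| ≤ c₁) (hh0 : ∀ μ x, |hX (τ μ x) - hX x| ≤ c₀)
    (hh1' : ∀ μ x', |fgrad n' (τ' μ) hX' x'| ≤ c₁) (hh1b' : ∀ μ x', |bgrad n' (τ' μ) hX' x'| ≤ c₁) (hh0' : ∀ μ x', |hX' (τ' μ x') - hX' x'| ≤ c₀)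
    (hf1 : ∀ μ x', |fgrad n' (τ' μ) hX' x' - fgrad n (τ μ) hX (π x')| ≤ o₁) (hf1b : ∀ μ x', |bgrad n' (τ' μ) hX' x' - bgrad n (τ μ) hX (π x')| ≤ o₁)
    (hf0 : ∀ μ x', |(hX' (τ' μ x') - hX' x') - (hX (τ μ (π x')) - hX (π x'))| ≤ o₀)
    (hf0b : ∀ μ x', |(hX' x' - hX' ((τ' μ).symm x')) - (hX (π x') - hX ((τ μ).symm (π x')))| ≤ o₀)
    (hfit : ∀ x', |hX' x' - hX (π x')| ≤ o) (hLip : ∀ y y', |hb y - hb y'| ≤ ℓ * g.dist y y') (hrh : ∀ x, |hX x - hb (blk x)| ≤ ω) (hrh' : ∀ x', |hX' x' - hb (blk (π x'))| ≤ ω)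
    (hlayf : ∀ μ x, hX x ≠ hX ((τ μ).symm x) → χX x = 1) (hlayb : ∀ μ x, hX (τ μ x) ≠ hX x → χX x = 1)
    (hlayf' : ∀ μ x', hX' x' ≠ hX' ((τ' μ).symm x') → χX' x' = 1) (hlayb' : ∀ μ x', hX' (τ' μ x') ≠ hX' x' → χX' x' = 1)
    -- species rows and translated fits; the `W`-rows' defect; nonlocal commutator letters; base parts
    (hA : ∀ j x i, ∑ k, |A j x i k| ≤ rA)
    (hfAb : ∀ μ x' i, ∑ k, |A' (Sum.inl μ) ((τ' μ).symm x') i k - A (Sum.inl μ) ((τ μ).symm (π x')) i k| ≤ oAt)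
    (hfAf : ∀ μ x' i, ∑ k, |A' (Sum.inr μ) (τ' μ x') i k - A (Sum.inr μ) (τ μ (π x')) i k| ≤ oAt)
    (hDW : HasMaj (BlockNorm.ofBlocks g (liftBlk blk ι)) (BlockNorm.ofBlocks g (liftBlk (blk ∘ π) ι))
      (idef (pull (liftMap π ι)) (pull (liftMap π ι))
        ((projO none ∘ₗ bgPropV (stack (mulOp (fun p : X' × ι => χtX' p.1) ∘ₗ N')
          (fun j => Sum.elim (fun μ => fgrad n' (liftEquiv (τ' μ) ι)) (fun μ => bgrad n' (liftEquiv (τ' μ) ι)) j ∘ₗ (mulOp (fun p : X' × ι => χtX' p.1) ∘ₗ N'))) (unstackM C' A' + NV' ∘ₗ projO (none : Option (J ⊕ J)))) ∘ₗ commOp W' (fun p : X' × ι => hX' p.1))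
        ((projO none ∘ₗ bgPropV (stack (mulOp (fun p : X × ι => χtX p.1) ∘ₗ N)
          (fun j => Sum.elim (fun μ => fgrad n (liftEquiv (τ μ) ι)) (fun μ => bgrad n (liftEquiv (τ μ) ι)) j ∘ₗ (mulOp (fun p : X × ι => χtX p.1) ∘ₗ N))) (unstackM C A + NV ∘ₗ projO (none : Option (J ⊕ J)))) ∘ₗ commOp W (fun p : X × ι => hX p.1)))
      (fun y y' => ind S y * ind S y' * (rW * Real.exp (-(ρ₂ * g.dist y y')))))
    (hKN : HasMaj (BlockNorm.ofBlocks g (liftBlk blk ι)) (BlockNorm.ofBlocks g (liftBlk blk ι)) (commOp NL (fun p : X × ι => hX p.1)) (fun y y' => cN * Real.exp (-(ρN * g.dist y y'))))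
    (hDKN : HasMaj (BlockNorm.ofBlocks g (liftBlk blk ι)) (BlockNorm.ofBlocks g (liftBlk (blk ∘ π) ι))
      (idef (pull (liftMap π ι)) (pull (liftMap π ι)) (commOp NL' (fun p : X' × ι => hX' p.1)) (commOp NL (fun p : X × ι => hX p.1))) (fun y y' => rN * Real.exp (-(ρN * g.dist y y'))))
    (hNV : HasMaj (BlockNorm.ofBlocks g (liftBlk blk ι)) (BlockNorm.ofBlocks g (liftBlk blk ι)) NV (fun y y' => RN * Real.exp (-(δN * g.dist y y'))))
    (hNV' : HasMaj (BlockNorm.ofBlocks g (liftBlk (blk ∘ π) ι)) (BlockNorm.ofBlocks g (liftBlk (blk ∘ π) ι)) NV' (fun y y' => RN * Real.exp (-(δN * g.dist y y'))))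
    (hDNV : HasMaj (BlockNorm.ofBlocks g (liftBlk blk ι)) (BlockNorm.ofBlocks g (liftBlk (blk ∘ π) ι)) (idef (pull (liftMap π ι)) (pull (liftMap π ι)) NV' NV) (fun y y' => rV * Real.exp (-(δN * g.dist y y')))) :
    HasMaj (BlockNorm.ofBlocks g (liftBlk blk ι)) (BlockNorm.ofBlocks g (liftBlk (blk ∘ π) ι))
      (idef (pull (liftMap π ι)) (pull (liftMap π ι))
        ((projO none ∘ₗ bgPropV (stack (mulOp (fun p : X' × ι => χtX' p.1) ∘ₗ N')
          (fun j => Sum.elim (fun μ => fgrad n' (liftEquiv (τ' μ) ι)) (fun μ => bgrad n' (liftEquiv (τ' μ) ι)) j ∘ₗ (mulOp (fun p : X' × ι => χtX' p.1) ∘ₗ N'))) (unstackM C' A' + NV' ∘ₗ projO (none : Option (J ⊕ J)))) ∘ₗ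
          commOp (lapOp n' (fun μ => liftEquiv (τ' μ) ι) W' + NL' - (unstackM C' A' + NV' ∘ₗ projO (none : Option (J ⊕ J))) ∘ₗ
            stack LinearMap.id (fun j : J ⊕ J => Sum.elim (fun μ => fgrad n' (liftEquiv (τ' μ) ι)) (fun μ => bgrad n' (liftEquiv (τ' μ) ι)) j)) (fun p : X' × ι => hX' p.1))
        ((projO none ∘ₗ bgPropV (stack (mulOp (fun p : X × ι => χtX p.1) ∘ₗ N)
          (fun j => Sum.elim (fun μ => fgrad n (liftEquiv (τ μ) ι)) (fun μ => bgrad n (liftEquiv (τ μ) ι)) j ∘ₗ (mulOp (fun p : X × ι => χtX p.1) ∘ₗ N))) (unstackM C A + NV ∘ₗ projO (none : Option (J ⊕ J)))) ∘ₗ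
          commOp (lapOp n (fun μ => liftEquiv (τ μ) ι) W + NL - (unstackM C A + NV ∘ₗ projO (none : Option (J ⊕ J))) ∘ₗ
            stack LinearMap.id (fun j : J ⊕ J => Sum.elim (fun μ => fgrad n (liftEquiv (τ μ) ι)) (fun μ => bgrad n (liftEquiv (τ μ) ι)) j)) (fun p : X × ι => hX p.1)))
      (fun y y' => ind S y * ((((((Fintype.card J : ℝ) * (3 * (((β + (β₁ + ct * β)) * (1 - (β + (β₁ + ct * β)) * (R * cr) * cr)⁻¹) * o₂ + mX * c₂) + 2 * (((1 - θA * cr)⁻¹ * βQ * cr) * o₁ + ((1 - θA * cr)⁻¹ * (1 * mQ + oχ * βQ) * cr + (1 - θA * cr)⁻¹ * (r𝒲 * ((1 - θA * cr)⁻¹ * βQ * cr) * cr) * cr) * c₁)) + rW) + ((β + (β₁ + ct * β)) * (1 - (β + (β₁ + ct * β)) * (R * cr) * cr)⁻¹) * rN * cr + mX * cN * cr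
        + ((Fintype.card J : ℝ) * (2 * (rA * (c₁ * mX + o₁ * ((β + (β₁ + ct * β)) * (1 - (β + (β₁ + ct * β)) * (R * cr) * cr)⁻¹) + c₀ * ((1 - θA * cr)⁻¹ * (1 * mQ + oχ * βQ) * cr + (1 - θA * cr)⁻¹ * (r𝒲 * ((1 - θA * cr)⁻¹ * βQ * cr) * cr) * cr) + o₀ * ((1 - θA * cr)⁻¹ * βQ * cr)) + oAt * (c₁ * ((β + (β₁ + ct * β)) * (1 - (β + (β₁ + ct * β)) * (R * cr) * cr)⁻¹) + c₀ * ((1 - θA * cr)⁻¹ * βQ * cr)))) +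
          ((β + (β₁ + ct * β)) * (1 - (β + (β₁ + ct * β)) * (R * cr) * cr)⁻¹) * (((ℓ * (Real.exp 1 * ε)⁻¹ + 2 * ω) * rV + 2 * o * RN)) * cr + mX * ((ℓ * (Real.exp 1 * ε)⁻¹ + 2 * ω) * RN) * cr))) * Real.exp (-(ρ₃ * g.dist y y'))))) := by
  have hβb : 0 ≤ β + (β₁ + ct * β) := by positivity
  have hB : 0 ≤ (β + (β₁ + ct * β)) * (1 - (β + (β₁ + ct * β)) * (R * cr) * cr)⁻¹ := mul_nonneg hβb (inv_nonneg.2 (by linarith))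
  have hinv : 0 ≤ (1 - θA * cr)⁻¹ := inv_nonneg.2 (by linarith)
  have hBX : 0 ≤ (1 - θA * cr)⁻¹ * βQ * cr := mul_nonneg (mul_nonneg hinv hβQ) hcr
  have hmF : 0 ≤ 1 * mQ + oχ * βQ := by positivity
  have hmTX : 0 ≤ (1 - θA * cr)⁻¹ * (1 * mQ + oχ * βQ) * cr + (1 - θA * cr)⁻¹ * (r𝒲 * ((1 - θA * cr)⁻¹ * βQ * cr) * cr) * cr :=
    add_nonneg (mul_nonneg (mul_nonneg hinv hmF) hcr) (mul_nonneg (mul_nonneg hinv (mul_nonneg (mul_nonneg hr𝒲 hBX) hcr)) hcr)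
  have h2σ : 2 * σ ≤ δW := by linarith
  -- entry 0 of the fine dressed smooth-cut cube, two-sided (file 34 at the fine grid)
  have hG0' := hasMaj_smoothCutDressed_loc₂ (blk ∘ π) τ' n' htri hd hrow hσ hβ hβ₁ hct hR hcr hσρ hρ₁V hρ₁G hρ₂ hρ₂₁ hSχ' hSψ' hχt' hdχt' hdχtb' hsub' hχ' hs' hsb' hdd' hddb' hNψ' hcut' hcutF'
    hcutB' hV' hq
  -- the units at both grids
  have hGf := hasMaj_smoothCut_flat blk (S := S) hβ hβ₁ hct hχt hsub hcut
  have hDf := hasMaj_jet_smoothCut_flat blk τ n (S := S) hβ hβ₁ hct hχt hdχt hdχtb hs hsb hdd hddb hcut hcutF hcutB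
  have hunit := (hasMaj_dressedV_pair blk htri hd hrow hσ hβb hR hcr hσρ hρ₁V hρ₁G hρ₂ hρ₂₁ hGf hDf hV hq).1
  have hGf' := hasMaj_smoothCut_flat (blk ∘ π) (S := S) hβ hβ₁ hct hχt' hsub' hcut'
  have hDf' := hasMaj_jet_smoothCut_flat (blk ∘ π) τ' n' (S := S) hβ hβ₁ hct hχt' hdχt' hdχtb' hs' hsb' hdd' hddb' hcut' hcutF' hcutB'
  have hunit' := (hasMaj_dressedV_pair (blk ∘ π) htri hd hrow hσ hβb hR hcr hσρ hρ₁V hρ₁G hρ₂ hρ₂₁ hGf' hDf' hV' hq).1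
  have hunitW := isUnit_neumannR (liftBlk blk ι) hd hrow hθA (by linarith) hW𝒲 hqA
  have hunitW' := isUnit_neumannR (liftBlk (blk ∘ π) ι) hd hrow hθA (by linarith) hW𝒲' hqA
  -- the sandwiched right entries of `X°`, `X°′`
  have hDj : ∀ j, (fun j => Sum.elim (fun μ => fgrad n (liftEquiv (τ μ) ι)) (fun μ => bgrad n (liftEquiv (τ μ) ι)) j ∘ₗ (mulOp (fun p : X × ι => χtX p.1) ∘ₗ N)) j =
      (fun j => Sum.elim (fun μ => fgrad n (liftEquiv (τ μ) ι)) (fun μ => bgrad n (liftEquiv (τ μ) ι)) j) j ∘ₗ (mulOp (fun p : X × ι => χtX p.1) ∘ₗ N) := fun _ => rfl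
  have hDj' : ∀ j, (fun j => Sum.elim (fun μ => fgrad n' (liftEquiv (τ' μ) ι)) (fun μ => bgrad n' (liftEquiv (τ' μ) ι)) j ∘ₗ (mulOp (fun p : X' × ι => χtX' p.1) ∘ₗ N')) j =
      (fun j => Sum.elim (fun μ => fgrad n' (liftEquiv (τ' μ) ι)) (fun μ => bgrad n' (liftEquiv (τ' μ) ι)) j) j ∘ₗ (mulOp (fun p : X' × ι => χtX' p.1) ∘ₗ N') := fun _ => rfl
  have hsXf := fun μ => smoothCutDressed_comp_grad_sandwich τ n (V := unstackM C A + NV ∘ₗ projO (none : Option (J ⊕ J))) hDj hunit hχ hunitW (hTf μ)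
  have hsXb := fun μ => smoothCutDressed_comp_grad_sandwich τ n (V := unstackM C A + NV ∘ₗ projO (none : Option (J ⊕ J))) hDj hunit hχ hunitW (hTb μ)
  have hsXf' := fun μ => smoothCutDressed_comp_grad_sandwich τ' n' (V := unstackM C' A' + NV' ∘ₗ projO (none : Option (J ⊕ J))) hDj' hunit' hχ' hunitW' (hTf' μ)
  have hsXb' := fun μ => smoothCutDressed_comp_grad_sandwich τ' n' (V := unstackM C' A' + NV' ∘ₗ projO (none : Option (J ⊕ J))) hDj' hunit' hχ' hunitW' (hTb' μ)
  -- the adjoint letters are cut on the left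
  have hWχ : mulOp (fun p : X × ι => χX p.1) ∘ₗ ((mulOp (fun p : X × ι => χtX p.1) ∘ₗ N) ∘ₗ (unstackM C A + NV ∘ₗ projO (none : Option (J ⊕ J))) ∘ₗ
        stack LinearMap.id (fun j => Sum.elim (fun μ => fgrad n (liftEquiv (τ μ) ι)) (fun μ => bgrad n (liftEquiv (τ μ) ι)) j) ∘ₗ mulOp (fun p : X × ι => χX p.1)) =
      ((mulOp (fun p : X × ι => χtX p.1) ∘ₗ N) ∘ₗ (unstackM C A + NV ∘ₗ projO (none : Option (J ⊕ J))) ∘ₗ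
        stack LinearMap.id (fun j => Sum.elim (fun μ => fgrad n (liftEquiv (τ μ) ι)) (fun μ => bgrad n (liftEquiv (τ μ) ι)) j) ∘ₗ mulOp (fun p : X × ι => χX p.1)) := by
    simp only [← LinearMap.comp_assoc]
    rw [hχ]
  have hWχ' : mulOp (fun p : X' × ι => χX' p.1) ∘ₗ ((mulOp (fun p : X' × ι => χtX' p.1) ∘ₗ N') ∘ₗ (unstackM C' A' + NV' ∘ₗ projO (none : Option (J ⊕ J))) ∘ₗ
        stack LinearMap.id (fun j => Sum.elim (fun μ => fgrad n' (liftEquiv (τ' μ) ι)) (fun μ => bgrad n' (liftEquiv (τ' μ) ι)) j) ∘ₗ mulOp (fun p : X' × ι => χX' p.1)) =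
      ((mulOp (fun p : X' × ι => χtX' p.1) ∘ₗ N') ∘ₗ (unstackM C' A' + NV' ∘ₗ projO (none : Option (J ⊕ J))) ∘ₗ
        stack LinearMap.id (fun j => Sum.elim (fun μ => fgrad n' (liftEquiv (τ' μ) ι)) (fun μ => bgrad n' (liftEquiv (τ' μ) ι)) j) ∘ₗ mulOp (fun p : X' × ι => χX' p.1)) := by
    simp only [← LinearMap.comp_assoc]
    rw [hχ']
  have rate : ∀ {c : ℝ} (_ : 0 ≤ c) (y y' : g.Site), ind S y * ind S y' * (c * Real.exp (-((δW - 2 * σ) * g.dist y y'))) ≤ ind S y * ind S y' * (c * Real.exp (-(ρ₂ * g.dist y y'))) :=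
    fun hc y y' => mul_le_mul_of_nonneg_left (exp_rate_mono hd hc (by linarith) y y') (mul_nonneg (ind_nonneg _ _) (ind_nonneg _ _))
  -- fine rows of the adjoint right entries (FILE 153 ★)
  have hTXf' := fun μ => (hasMaj_adjRightEntry_loc₂ (blk ∘ π) htri hd hd0 hrow hσ hcr hSχ' hSψ₂' hχt' hWχ' hχ' (hTfψ' μ) hβQ hθA h2σ hW𝒲' (hTfr' μ) hqA).mono fun y y' => rate hBX y y'
  have hTXb' := fun μ => (hasMaj_adjRightEntry_loc₂ (blk ∘ π) htri hd hd0 hrow hσ hcr hSχ' hSψ₂' hχt' hWχ' hχ' (hTbψ' μ) hβQ hθA h2σ hW𝒲' (hTbr' μ) hqA).mono fun y y' => rate hBX y y'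
  -- defects of the adjoint right entries (§1 + FILE 148 §3)
  have hFχ : ∀ T : (X × ι → ℝ) →ₗ[ℝ] (X × ι → ℝ), mulOp (fun p : X × ι => χX p.1) ∘ₗ (mulOp (fun p : X × ι => χtX p.1) ∘ₗ T) = mulOp (fun p : X × ι => χtX p.1) ∘ₗ T := fun T => by
    rw [← LinearMap.comp_assoc, hχ]
  have hFχ' : ∀ T : (X' × ι → ℝ) →ₗ[ℝ] (X' × ι → ℝ), mulOp (fun p : X' × ι => χX' p.1) ∘ₗ (mulOp (fun p : X' × ι => χtX' p.1) ∘ₗ T) = mulOp (fun p : X' × ι => χtX' p.1) ∘ₗ T := fun T => by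
    rw [← LinearMap.comp_assoc, hχ']
  have hFψ : ∀ {T : (X × ι → ℝ) →ₗ[ℝ] (X × ι → ℝ)}, T ∘ₗ mulOp (fun p : X × ι => ψ₂X p.1) = T →
      (mulOp (fun p : X × ι => χtX p.1) ∘ₗ T) ∘ₗ mulOp (fun p : X × ι => ψ₂X p.1) = mulOp (fun p : X × ι => χtX p.1) ∘ₗ T := fun h => by rw [LinearMap.comp_assoc, h]
  have hFψ' : ∀ {T : (X' × ι → ℝ) →ₗ[ℝ] (X' × ι → ℝ)}, T ∘ₗ mulOp (fun p : X' × ι => ψ₂X' p.1) = T →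
      (mulOp (fun p : X' × ι => χtX' p.1) ∘ₗ T) ∘ₗ mulOp (fun p : X' × ι => ψ₂X' p.1) = mulOp (fun p : X' × ι => χtX' p.1) ∘ₗ T := fun h => by rw [LinearMap.comp_assoc, h]
  have hF : ∀ {T : (X × ι → ℝ) →ₗ[ℝ] (X × ι → ℝ)}, HasMaj (BlockNorm.ofBlocks g (liftBlk blk ι)) (BlockNorm.ofBlocks g (liftBlk blk ι)) T (fun y y' => ind S y * ind S y' * (βQ * Real.exp (-(δW * g.dist y y')))) →
      HasMaj (BlockNorm.ofBlocks g (liftBlk blk ι)) (BlockNorm.ofBlocks g (liftBlk blk ι)) (mulOp (fun p : X × ι => χtX p.1) ∘ₗ T) (fun y y' => βQ * Real.exp (-(δW * g.dist y y'))) := fun hT =>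
    (hasMaj_diag_comp (liftBlk blk ι) (fun _ => zero_le_one) (hasMaj_mulOp (g := g) (liftBlk blk ι) (m := fun _ => (1 : ℝ)) (fun _ => zero_le_one) (fun p : X × ι => hχt p.1))
      (hT.mono fun y y' => loc₂_le_plain hβQ y y')).mono fun y y' => le_of_eq (one_mul _)
  have hDF : ∀ {T : (X × ι → ℝ) →ₗ[ℝ] (X × ι → ℝ)} {T' : (X' × ι → ℝ) →ₗ[ℝ] (X' × ι → ℝ)},
      HasMaj (BlockNorm.ofBlocks g (liftBlk blk ι)) (BlockNorm.ofBlocks g (liftBlk blk ι)) T (fun y y' => ind S y * ind S y' * (βQ * Real.exp (-(δW * g.dist y y')))) →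
      HasMaj (BlockNorm.ofBlocks g (liftBlk blk ι)) (BlockNorm.ofBlocks g (liftBlk (blk ∘ π) ι)) (idef (pull (liftMap π ι)) (pull (liftMap π ι)) T' T) (fun y y' => mQ * Real.exp (-(δW * g.dist y y'))) →
      HasMaj (BlockNorm.ofBlocks g (liftBlk blk ι)) (BlockNorm.ofBlocks g (liftBlk (blk ∘ π) ι))
        (idef (pull (liftMap π ι)) (pull (liftMap π ι)) (mulOp (fun p : X' × ι => χtX' p.1) ∘ₗ T') (mulOp (fun p : X × ι => χtX p.1) ∘ₗ T)) (fun y y' => (1 * mQ + oχ * βQ) * Real.exp (-(δW * g.dist y y'))) :=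
    fun hT hD => hasMaj_idef_mulOp_comp_plain blk π zero_le_one hoχ hχt' hfitχ (hT.mono fun y y' => loc₂_le_plain hβQ y y') hD
  have hDTXf := fun μ => (hasMaj_idef_neumannR_comp_loc₂ blk π htri hd hd0 hrow hσ hcr hSχ hSψ₂ hSχ' hSψ₂' hWχ (hFχ (Tf μ)) (hFψ (hTfψ μ)) hWχ' (hFχ' (Tf' μ)) (hFψ' (hTfψ' μ)) hβQ hθA hmF hr𝒲
    h2σ hW𝒲 hW𝒲' hD𝒲 (hF (hTfr μ)) (hDF (hTfr μ) (hDTf μ)) hqA).mono fun y y' => rate hmTX y y'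
  have hDTXb := fun μ => (hasMaj_idef_neumannR_comp_loc₂ blk π htri hd hd0 hrow hσ hcr hSχ hSψ₂ hSχ' hSψ₂' hWχ (hFχ (Tb μ)) (hFψ (hTbψ μ)) hWχ' (hFχ' (Tb' μ)) (hFψ' (hTbψ' μ)) hβQ hθA hmF hr𝒲
    h2σ hW𝒲 hW𝒲' hD𝒲 (hF (hTbr μ)) (hDF (hTbr μ) (hDTb μ)) hqA).mono fun y y' => rate hmTX y y'
  -- FILE 155
  exact hasMaj_idef_comp_commOp_cubeOp_out_of_sandwich blk π τ τ' n n' C C' A A' hX hX' _ _ htri hd hsymm hrow hσ hB hBX hmX hmTX hc₁ hc₂ hc₀ ho₁ ho₂ ho₀ ho hrA hoAt hrW hcN hrN hRN hrV hℓ hω hε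
    hρ₃ hρ₃N hρ₃V hρ₃₂ hhD hhB hh2 hh2f hh2b hfD hfB hf2 hf2f hf2b hh1 hh1b hh0 hh1' hh1b' hh0' hf1 hf1b hf0 hf0b hfit hLip hrh hrh' hlayf hlayb hlayf' hlayb' hA hfAb hfAf hsXf hsXb hsXf' hsXb'
    hG0' hTXf' hTXb' hDG0 hDTXf hDTXb hDW hKN hDKN hNV hNV' hDNV

end Summit.QuantumFields.YangMills.BalabanUVNodes.N15.Gluing

end
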